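import Literature.Geometry.Riemannian.NeumannWeakExistence
import Literature.Geometry.Riemannian.DirichletMinimiserEnergy
import Literature.Geometry.Riemannian.OneFormKatoInequality
import Literature.Geometry.Riemannian.GaussBonnetGradient
import Literature.Geometry.Lorentzian.DivergenceTheoremCompactSupport
import Literature.Geometry.Lorentzian.VolumePositivity
import Literature.Analysis.FluidPDE.NSGaldiVorticityL2
import Mathlib.Analysis.Distribution.AEEqOfIntegralContDiff
import HarnessLib

/-!
# The equation satisfied by a regular representative of the weak Neumann solution:
# `f Δ_h w + ⟨∇f, ∇w⟩ = F` pointwise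

Topic `Geometry/Riemannian`. Theorem file (no definitions, no named facts; everything proved), on
the discharge path of `Literature.Geometry.Riemannian.sharpLogSobolevAVR_four`.

Let `uₙ ∈ C^∞(P)` be the approximants of the weak solution of the Neumann problem
`div_h(f ∇u) = F` on the open set `D` produced by `exists_smooth_weakNeumann_approx`
(`NeumannWeakExistence.lean`): `uₙ → v` in `L²(D)` and
`∫_D f ⟨∇uₙ, ∇w⟩ dμ → -∫_D F w dμ` for every smooth `w`. If `w ∈ C²(P)` agrees with `v` a.e. on an
open `O ⊆ D`, then `f Δ_h w + h(∇f, ∇w) = F` at every point of `O`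
(`dalembertian_eq_of_weakNeumann_limit`). Proof: for `ζ ∈ C_c^∞(O)` two integrations by parts
(Green's identity and the divergence theorem for compactly supported fields,
`GreenIdentityCompactSupport.lean`, `DivergenceTheoremCompactSupport.lean`) give
`∫_D f⟨∇uₙ, ∇ζ⟩ = ∫ uₙ Lζ` with `Lζ = -Δ_h(fζ) + div(ζ ∇f)` continuous and supported in `O`; the
`L²(D)` limit replaces `uₙ` by `v = w`, two more integrations by parts give `-∫ ζ div(f∇w)`, so
`∫ ζ (div(f ∇w) - F) = 0` for all such `ζ`, whence the claim by the fundamental lemma of the calculus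
of variations on manifolds (Mathlib) and continuity. Also: the differential of a `C^{k+1}` function
is a `C^k` one-form and its gradient a `C^k` vector field (`contMDiff_grad_of_le`).

## References

* M. E. Taylor, *Partial Differential Equations I*, 2nd ed. (2011), Ch. 5 §1 and §7 (weak and
  classical solutions). [TaylorPDEI2011]
* J. M. Lee, *Introduction to Riemannian Manifolds*, 2nd ed. (2018), Problems 2-22, 2-23.
  [Lee2018]
-/

noncomputable section

open MeasureTheory Measure Set Filter Metric Module InnerProductSpace TopologicalSpace Function
open scoped ENNReal NNReal Manifold ContDiff Topology RealInnerProductSpace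

namespace Literature.Geometry.Riemannian

open Lorentzian
open Bundle PseudoRiemannianMetric Literature.Analysis.FunctionSpaces Literature.Analysis.FluidPDE

/-! ### Finite-order smoothness of differentials and gradients -/

section Grad

variable {E : Type*} [NormedAddCommGroup E] [NormedSpace ℝ E] {H : Type*} [TopologicalSpace H]
  {I : ModelWithCorners ℝ E H} {X : Type*} [TopologicalSpace X] [ChartedSpace H X]
  [IsManifold I ∞ X]

set_option backward.isDefEq.respectTransparency false in
/-- **`du` is a `C^k` section of `T*X` for `u ∈ C^{k+1}`** (finite-order version of
`contMDiffAt_oneFormSection_mvfderiv`). [folklore] -/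
theorem contMDiffAt_oneFormSection_mvfderiv_of_le {u : X → ℝ} {x₀ : X} {k n : ℕ∞ω}
    (hu : ContMDiffAt I 𝓘(ℝ, ℝ) n u x₀) (hkn : k + 1 ≤ n) :
    ContMDiffAt I (I.prod 𝓘(ℝ, E →L[ℝ] ℝ)) k (oneFormSection (mvfderiv I u)) x₀ := by
  rw [contMDiffAt_hom_bundle]
  refine ⟨contMDiffAt_id, ?_⟩
  have h := hu.mfderiv_const (m := k) hkn
  refine h.congr_of_eventuallyEq ?_
  filter_upwards [(chartAt H x₀).open_source.mem_nhds (mem_chart_source H x₀)] with x hx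
  have h1 : (trivializationAt ℝ (fun _ : X ↦ ℝ) x₀).continuousLinearMapAt ℝ x =
      ContinuousLinearMap.id ℝ ℝ :=
    Bundle.Trivial.continuousLinearMapAt_trivialization ℝ X ℝ x
  have h2 : (trivializationAt ℝ (TangentSpace 𝓘(ℝ, ℝ)) (u x₀)).continuousLinearMapAt ℝ (u x) =
      (1 : ℝ →L[ℝ] ℝ) :=
    TangentBundle.continuousLinearMapAt_model_space (u x₀) (u x)
  ext v
  simp only [inTangentCoordinates, ContinuousLinearMap.inCoordinates,
    ContinuousLinearMap.coe_comp, Function.comp_apply, mvfderiv, h1, h2, id_eq,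
    ContinuousLinearMap.id_apply]
  rfl

end Grad

variable {m : ℕ} {P : Type*} [TopologicalSpace P] [ChartedSpace (EuclideanSpace ℝ (Fin m)) P]
  [IsManifold (𝓡 m) ∞ P]

/-- **The gradient of a `C^{k+1}` function is a `C^k` vector field** (`k ≤ ∞`). [folklore] -/
theorem contMDiff_grad_of_le
    (g : PseudoRiemannianMetric (𝓡 m) ∞ (EuclideanSpace ℝ (Fin m)) (TangentSpace (𝓡 m) : P → Type _))
    {u : P → ℝ} {k n : ℕ∞ω} (hu : ContMDiff (𝓡 m) 𝓘(ℝ, ℝ) n u) (hkn : k + 1 ≤ n)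
    (hk : k ≤ (∞ : ℕ∞ω)) :
    ContMDiff (𝓡 m) ((𝓡 m).prod 𝓘(ℝ, EuclideanSpace ℝ (Fin m))) k
      (fun y ↦ TotalSpace.mk' (EuclideanSpace ℝ (Fin m)) y (grad g u y)) := fun x ↦
  contMDiffAt_sharp_oneForm g hk (contMDiffAt_oneFormSection_mvfderiv_of_le (hu x) hkn)

variable [T2Space P] [LocallyCompactSpace P] [SigmaCompactSpace P] [MeasurableSpace P] [BorelSpace P]
  (g : PseudoRiemannianMetric (𝓡 m) ∞ (EuclideanSpace ℝ (Fin m)) (TangentSpace (𝓡 m) : P → Type _))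
  [g.HasLeviCivita]

set_option maxHeartbeats 1600000 in
/-- **The equation holds pointwise for a `C²` representative of the weak Neumann solution**
(Taylor, *PDE I*, Ch. 5 §1, (1.4)–(1.6) and §7: a weak solution which is `C²` is a classical
solution): with the approximants `uₙ` of `exists_smooth_weakNeumann_approx`, if `w ∈ C²(P)` equals the
`L²(D)` limit `v` a.e. on an open `O ⊆ D`, then `f Δ_h w + h(∇f, ∇w) = F` on `O`.
[cite: TaylorPDEI2011, Ch. 5 §1, Proposition 1.1 ff. and §7] -/
theorem dalembertian_eq_of_weakNeumann_limit (hg : g.IsRiemannian) {D : Set P} (hDm : MeasurableSet D)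
    {KD : Set P} (hKD : IsCompact KD) (hDKD : D ⊆ KD) {u : ℕ → P → ℝ} (hus : ∀ n, ContMDiff (𝓡 m) 𝓘(ℝ, ℝ) ∞ (u n)) {v : P → ℝ}
    (hvm : MemLp v 2 ((riemannianMeasure (g.toContMDiffRiemannianMetric hg)).restrict D))
    (hL2 : Tendsto (fun n ↦ eLpNorm (u n - v) 2
      ((riemannianMeasure (g.toContMDiffRiemannianMetric hg)).restrict D)) atTop (𝓝 0))
    {f : P → ℝ} (hf : ContMDiff (𝓡 m) 𝓘(ℝ, ℝ) ∞ f) {F : P → ℝ} (hF : Continuous F)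
    (hweak : ∀ w : P → ℝ, ContMDiff (𝓡 m) 𝓘(ℝ, ℝ) ∞ w →
      Tendsto (fun n ↦ ∫ x in D, f x * g.innerDual x (mvfderiv (𝓡 m) (u n) x).toLinearMap
        (mvfderiv (𝓡 m) w x).toLinearMap ∂riemannianMeasure (g.toContMDiffRiemannianMetric hg))
        atTop (𝓝 (-∫ x in D, F x * w x ∂riemannianMeasure (g.toContMDiffRiemannianMetric hg))))
    {w : P → ℝ} (hw : ContMDiff (𝓡 m) 𝓘(ℝ, ℝ) 2 w) {O : Set P} (hO : IsOpen O) (hOD : O ⊆ D)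
    (hae : ∀ᵐ x ∂riemannianMeasure (g.toContMDiffRiemannianMetric hg), x ∈ O → w x = v x) :
    ∀ x ∈ O, f x * g.dalembertian w x + g.val x (grad g f x) (grad g w x) = F x := by
  set h := g.toContMDiffRiemannianMetric hg with hh_def
  haveI : (ofRiemannian h).HasLeviCivita := ‹g.HasLeviCivita›
  set μ : Measure P := riemannianMeasure h with hμ
  haveI : IsFiniteMeasureOnCompacts μ :=
    ⟨fun K hK ↦ riemannianVolume_lt_top_of_isCompact_holds _ le_rfl hK⟩
  haveI : μ.IsOpenPosMeasure := isOpenPosMeasure_riemannianMeasure h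
  have hOm : MeasurableSet O := hO.measurableSet
  have h1le : (1 : ℕ∞ω) ≤ 2 := by norm_cast
  -- the gradient fields
  have hgf : ContMDiff (𝓡 m) ((𝓡 m).prod 𝓘(ℝ, EuclideanSpace ℝ (Fin m))) 1
      (fun y ↦ TotalSpace.mk' (EuclideanSpace ℝ (Fin m)) y (grad g f y)) :=
    (contMDiff_grad g hf).of_le (by norm_cast)
  have hgw : ContMDiff (𝓡 m) ((𝓡 m).prod 𝓘(ℝ, EuclideanSpace ℝ (Fin m))) 1
      (fun y ↦ TotalSpace.mk' (EuclideanSpace ℝ (Fin m)) y (grad g w y)) :=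
    contMDiff_grad_of_le g hw (by norm_cast) (by norm_cast)
  have hw1 : ContMDiff (𝓡 m) 𝓘(ℝ, ℝ) 1 w := hw.of_le h1le
  have hf1 : ContMDiff (𝓡 m) 𝓘(ℝ, ℝ) 1 f := hf.of_le (by norm_cast)
  -- the field `f ∇w` and its divergence
  set Yw : (x : P) → TangentSpace (𝓡 m) x := (f : P → ℝ) • grad g w with hYw
  have hYw_apply : ∀ x, Yw x = f x • grad g w x := fun x ↦ rfl
  have hYw1 : ContMDiff (𝓡 m) ((𝓡 m).prod 𝓘(ℝ, EuclideanSpace ℝ (Fin m))) 1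
      (fun y ↦ TotalSpace.mk' (EuclideanSpace ℝ (Fin m)) y (Yw y)) := hf1.smul_section hgw
  have hdivYw : ∀ x, (ofRiemannian h).vectorDivergence Yw x =
      f x * g.dalembertian w x + g.val x (grad g f x) (grad g w x) := fun x ↦ by
    rw [hYw, vectorDivergence_smul ((hgw x).mdifferentiableAt one_ne_zero)
      ((hf1 x).mdifferentiableAt one_ne_zero)]
    congr 1
    · exact congrArg (fun t ↦ f x * t) (vectorDivergence_sharp_mvfderiv (g := ofRiemannian h) (hw x))
    · rw [val_grad]
  have hdivc : Continuous fun x ↦ (ofRiemannian h).vectorDivergence Yw x :=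
    continuous_vectorDivergence h hYw1
  -- it suffices to test against smooth functions compactly supported in `O`
  suffices key : ∀ ζ : P → ℝ, ContMDiff (𝓡 m) 𝓘(ℝ, ℝ) ∞ ζ → HasCompactSupport ζ → tsupport ζ ⊆ O →
      ∫ x, ζ x * ((ofRiemannian h).vectorDivergence Yw x - F x) ∂μ = 0 by
    have hloc : LocallyIntegrableOn (fun x ↦ (ofRiemannian h).vectorDivergence Yw x - F x) O μ :=
      (hdivc.sub hF).continuousOn.locallyIntegrableOn hOm
    have hae0 := hO.ae_eq_zero_of_integral_contMDiff_smul_eq_zero (I := 𝓡 m) hloc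
      (fun ζ hζ hζc hζO ↦ by simpa only [smul_eq_mul] using key ζ hζ hζc hζO)
    have hae' : (fun x ↦ (ofRiemannian h).vectorDivergence Yw x - F x) =ᵐ[μ.restrict O]
        fun _ ↦ (0 : ℝ) := (ae_restrict_iff' hOm).2 hae0
    have heq := Measure.eqOn_open_of_ae_eq hae' hO (hdivc.sub hF).continuousOn continuousOn_const
    intro x hx
    have := heq hx
    simp only at this
    rw [← hdivYw x]
    linarith
  intro ζ hζ hζc hζO
  have hζ1 : ContMDiff (𝓡 m) 𝓘(ℝ, ℝ) 1 ζ := hζ.of_le (by norm_cast)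
  have hζzero : ∀ x, x ∉ O → ζ x = 0 := fun x hx ↦ image_eq_zero_of_notMem_tsupport fun h' ↦ hx (hζO h')
  have hdζzero : ∀ x, x ∉ O → mvfderiv (𝓡 m) ζ x = 0 := fun x hx ↦
    mvfderiv_eq_zero_of_notMem_tsupport fun h' ↦ hx (hζO h')
  -- the operator `Lζ = -Δ_h(fζ) + div(ζ ∇f)`
  set fζ : P → ℝ := fun x ↦ f x * ζ x with hfζ
  have hfζs : ContMDiff (𝓡 m) 𝓘(ℝ, ℝ) ∞ fζ := hf.mul hζ
  have hfζ2 : ContMDiff (𝓡 m) 𝓘(ℝ, ℝ) 2 fζ := hfζs.of_le (by norm_cast)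
  have hfζc : HasCompactSupport fζ := hζc.mul_left
  set Zf : (x : P) → TangentSpace (𝓡 m) x := (ζ : P → ℝ) • grad g f with hZf
  have hZf_apply : ∀ x, Zf x = ζ x • grad g f x := fun x ↦ rfl
  have hZf1 : ContMDiff (𝓡 m) ((𝓡 m).prod 𝓘(ℝ, EuclideanSpace ℝ (Fin m))) 1
      (fun y ↦ TotalSpace.mk' (EuclideanSpace ℝ (Fin m)) y (Zf y)) := hζ1.smul_section hgf
  have hZfc : HasCompactSupport fun x ↦ (Zf x : EuclideanSpace ℝ (Fin m)) := by
    refine hζc.mono fun y hy ↦ ?_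
    rw [Function.mem_support] at hy ⊢
    intro h0; apply hy
    rw [hZf_apply, h0, zero_smul]; rfl
  set L : P → ℝ := fun x ↦ -(ofRiemannian h).dalembertian fζ x + (ofRiemannian h).vectorDivergence Zf x
    with hL
  have hLc : Continuous L :=
    (continuous_dalembertian _ hfζ2).neg.add (continuous_vectorDivergence h hZf1)
  have hLzero : ∀ x, x ∉ tsupport ζ → L x = 0 := fun x hx ↦ by
    have hev : ζ =ᶠ[𝓝 x] fun _ ↦ 0 := notMem_tsupport_iff_eventuallyEq.1 hx
    have h1 : (ofRiemannian h).dalembertian fζ x = 0 := by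
      refine dalembertian_eq_zero_of_eventuallyEq_zero (ofRiemannian h) ?_
      filter_upwards [hev] with y hy
      show f y * ζ y = 0
      rw [hy, mul_zero]
    have h2 : (ofRiemannian h).vectorDivergence Zf x = 0 := by
      refine vectorDivergence_eq_zero_of_eventuallyEq_zero ?_
      filter_upwards [hev] with y hy
      rw [hZf_apply, hy, zero_smul]
    rw [hL]; simp only [h1, h2, neg_zero, add_zero]
  have hLsupp : HasCompactSupport L :=
    HasCompactSupport.intro' hζc (isClosed_tsupport _) hLzero
  -- Step 1: `∫_D f⟨∇q, ∇ζ⟩ = ∫ q L` for every `C¹` function `q`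
  have hstep : ∀ q : P → ℝ, ContMDiff (𝓡 m) 𝓘(ℝ, ℝ) 1 q →
      ∫ x in D, f x * g.innerDual x (mvfderiv (𝓡 m) q x).toLinearMap
        (mvfderiv (𝓡 m) ζ x).toLinearMap ∂μ = ∫ x, q x * L x ∂μ := by
    intro q hq
    -- pointwise: `f⟨dq, dζ⟩ = ⟨dq, d(fζ)⟩ - ζ⟨dq, df⟩ = ⟨dq, d(fζ)⟩ - dq(ζ ∇f)`
    have hpt : ∀ x, f x * g.innerDual x (mvfderiv (𝓡 m) q x).toLinearMap
        (mvfderiv (𝓡 m) ζ x).toLinearMap =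
        (ofRiemannian h).innerDual x (mvfderiv (𝓡 m) q x).toLinearMap
          (mvfderiv (𝓡 m) fζ x).toLinearMap - mvfderiv (𝓡 m) q x (Zf x) := by
      intro x
      have hprod : mvfderiv (𝓡 m) fζ x = f x • mvfderiv (𝓡 m) ζ x + ζ x • mvfderiv (𝓡 m) f x := by
        rw [hfζ]
        exact mvfderiv_fun_mul ((hf1 x).mdifferentiableAt one_ne_zero)
          ((hζ1 x).mdifferentiableAt one_ne_zero)
      have e2 : mvfderiv (𝓡 m) q x (Zf x) =
          ζ x * g.innerDual x (mvfderiv (𝓡 m) q x).toLinearMap (mvfderiv (𝓡 m) f x).toLinearMap := by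
        rw [hZf_apply, map_smul, smul_eq_mul]
        rfl
      rw [e2, hprod, ContinuousLinearMap.toLinearMap_add, ContinuousLinearMap.toLinearMap_smul,
        ContinuousLinearMap.toLinearMap_smul]
      show _ = (mvfderiv (𝓡 m) q x).toLinearMap (g.sharp x (f x • (mvfderiv (𝓡 m) ζ x).toLinearMap +
        ζ x • (mvfderiv (𝓡 m) f x).toLinearMap)) - _
      rw [map_add, map_smul, map_smul, map_add, map_smul, map_smul, smul_eq_mul, smul_eq_mul]
      show f x * (mvfderiv (𝓡 m) q x).toLinearMap (g.sharp x (mvfderiv (𝓡 m) ζ x).toLinearMap) =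
        f x * (mvfderiv (𝓡 m) q x).toLinearMap (g.sharp x (mvfderiv (𝓡 m) ζ x).toLinearMap) +
          ζ x * (mvfderiv (𝓡 m) q x).toLinearMap (g.sharp x (mvfderiv (𝓡 m) f x).toLinearMap) -
          ζ x * (mvfderiv (𝓡 m) q x).toLinearMap (g.sharp x (mvfderiv (𝓡 m) f x).toLinearMap)
      ring
    -- both integrals over `D` are integrals over `P`
    have hI : ∫ x in D, f x * g.innerDual x (mvfderiv (𝓡 m) q x).toLinearMap
        (mvfderiv (𝓡 m) ζ x).toLinearMap ∂μ = ∫ x, f x * g.innerDual x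
          (mvfderiv (𝓡 m) q x).toLinearMap (mvfderiv (𝓡 m) ζ x).toLinearMap ∂μ := by
      refine setIntegral_eq_integral_of_forall_compl_eq_zero fun x hx ↦ ?_
      rw [hdζzero x (fun h' ↦ hx (hOD h'))]
      simp [PseudoRiemannianMetric.innerDual]
    rw [hI]
    simp_rw [hpt]
    have hG := integral_mul_dalembertian_eq_neg_integral_innerDual_of_hasCompactSupport_right h hq
      hfζ2 hfζc
    have hV := integral_mul_vectorDivergence_eq_neg_integral_mvfderiv_of_hasCompactSupport_right h hq
      hZf1 hZfc
    have hi1 : Integrable (fun x ↦ (ofRiemannian h).innerDual x (mvfderiv (𝓡 m) q x).toLinearMap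
        (mvfderiv (𝓡 m) fζ x).toLinearMap) μ := by
      refine integrable_of_continuous_of_hasCompactSupport h
        (continuous_innerDual_mvfderiv g hq (hfζ2.of_le h1le)) ?_
      refine HasCompactSupport.intro' hfζc (isClosed_tsupport _) fun y hy ↦ ?_
      rw [mvfderiv_eq_zero_of_notMem_tsupport hy]
      simp [PseudoRiemannianMetric.innerDual]
    have hi2 : Integrable (fun x ↦ mvfderiv (𝓡 m) q x (Zf x)) μ := by
      have hc : Continuous fun x ↦ mvfderiv (𝓡 m) q x (Zf x) := by
        have := continuous_innerDual_mvfderiv g hq hf1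
        have e : (fun x ↦ mvfderiv (𝓡 m) q x (Zf x)) = fun x ↦ ζ x *
            g.innerDual x (mvfderiv (𝓡 m) q x).toLinearMap (mvfderiv (𝓡 m) f x).toLinearMap := by
          funext x
          rw [hZf_apply, map_smul, smul_eq_mul]; rfl
        rw [e]; exact hζ.continuous.mul this
      refine integrable_of_continuous_of_hasCompactSupport h hc ?_
      refine hζc.mono fun y hy ↦ ?_
      rw [Function.mem_support] at hy ⊢
      intro h0; apply hy
      rw [hZf_apply, h0, zero_smul, map_zero]
    rw [integral_sub hi1 hi2]
    have hi3 : Integrable (fun x ↦ q x * (ofRiemannian h).dalembertian fζ x) μ :=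
      integrable_of_continuous_of_hasCompactSupport h (hq.continuous.mul (continuous_dalembertian _ hfζ2))
        (HasCompactSupport.intro' hfζc (isClosed_tsupport _) fun y hy ↦ by
          rw [dalembertian_eq_zero_of_notMem_tsupport (ofRiemannian h) hy, mul_zero])
    have hi4 : Integrable (fun x ↦ q x * (ofRiemannian h).vectorDivergence Zf x) μ := by
      refine integrable_of_continuous_of_hasCompactSupport h
        (hq.continuous.mul (continuous_vectorDivergence h hZf1)) ?_
      refine HasCompactSupport.intro' hζc (isClosed_tsupport _) fun y hy ↦ ?_
      have hev : ζ =ᶠ[𝓝 y] fun _ ↦ 0 := notMem_tsupport_iff_eventuallyEq.1 hy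
      rw [vectorDivergence_eq_zero_of_eventuallyEq_zero (by
        filter_upwards [hev] with z hz
        rw [hZf_apply, hz, zero_smul]), mul_zero]
    have hi3' : Integrable (fun x ↦ -(q x * (ofRiemannian h).dalembertian fζ x)) μ := hi3.neg
    have hsplit : ∫ x, q x * L x ∂μ = -∫ x, q x * (ofRiemannian h).dalembertian fζ x ∂μ +
        ∫ x, q x * (ofRiemannian h).vectorDivergence Zf x ∂μ := by
      rw [← integral_neg, ← integral_add hi3' hi4]
      refine integral_congr_ae (Eventually.of_forall fun x ↦ ?_)
      simp only [hL]; ring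
    rw [hsplit, hG, hV]
    ring
  -- Step 2: pass to the limit in `∫ uₙ L = ∫_D uₙ L`
  have hLzero' : ∀ x, x ∉ D → L x = 0 := fun x hx ↦ hLzero x fun h' ↦ hx (hOD (hζO h'))
  have hDfin : μ D < ⊤ := (measure_mono hDKD).trans_lt hKD.measure_lt_top
  haveI : IsFiniteMeasure (μ.restrict D) := ⟨by rwa [Measure.restrict_apply_univ]⟩
  have hLm : MemLp L 2 (μ.restrict D) := hLc.memLp_of_hasCompactSupport hLsupp
  have hum : ∀ n, MemLp (u n) 2 (μ.restrict D) := fun n ↦ by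
    obtain ⟨C, hC⟩ := hKD.exists_bound_of_continuousOn (hus n).continuous.continuousOn
    exact MemLp.of_bound (hus n).continuous.aestronglyMeasurable C
      (ae_restrict_of_forall_mem hDm fun x hx ↦ hC x (hDKD hx))
  have hlimL : Tendsto (fun n ↦ ∫ x, u n x * L x ∂μ) atTop (𝓝 (∫ x in D, L x * v x ∂μ)) := by
    have e : ∀ n, ∫ x, u n x * L x ∂μ = ∫ x in D, L x * u n x ∂μ := fun n ↦ by
      rw [← setIntegral_eq_integral_of_forall_compl_eq_zero (s := D) fun x hx ↦ by
        rw [hLzero' x hx, mul_zero]]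
      exact integral_congr_ae (Eventually.of_forall fun x ↦ mul_comm _ _)
    simp_rw [e]
    have := tendsto_integral_bilin_of_tendsto_eLpNorm (μ := μ.restrict D) (p := 2) (q := 2)
      (ContinuousLinearMap.mul ℝ ℝ) hLm hum hvm hL2
    simpa only [ContinuousLinearMap.mul_apply'] using this
  -- Step 3: the limit is `∫ w L = ∫_D f⟨∇w, ∇ζ⟩ = -∫ ζ div(f ∇w)`
  have hvw : ∫ x in D, L x * v x ∂μ = ∫ x, w x * L x ∂μ := by
    have e1 : ∫ x, w x * L x ∂μ = ∫ x in D, w x * L x ∂μ :=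
      (setIntegral_eq_integral_of_forall_compl_eq_zero fun x hx ↦ by
        rw [hLzero' x hx, mul_zero]).symm
    rw [e1]
    refine integral_congr_ae ?_
    have hae' : ∀ᵐ x ∂μ.restrict D, x ∈ O → w x = v x := ae_restrict_of_ae hae
    filter_upwards [hae'] with x hx
    by_cases hxO : x ∈ O
    · rw [hx hxO, mul_comm]
    · rw [hLzero x fun h' ↦ hxO (hζO h'), zero_mul, mul_zero]
  have hwfin : ∫ x, w x * L x ∂μ = -∫ x, ζ x * (ofRiemannian h).vectorDivergence Yw x ∂μ := by
    rw [← hstep w hw1, integral_mul_vectorDivergence_eq_neg_integral_mvfderiv_of_hasCompactSupport h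
      hζ1 hζc hYw1, neg_neg]
    have e2 : ∫ x, mvfderiv (𝓡 m) ζ x (Yw x) ∂μ = ∫ x in D, mvfderiv (𝓡 m) ζ x (Yw x) ∂μ :=
      (setIntegral_eq_integral_of_forall_compl_eq_zero fun x hx ↦ by
        rw [hdζzero x (fun h' ↦ hx (hOD h'))]; rfl).symm
    rw [e2]
    refine setIntegral_congr_fun hDm fun x _ ↦ ?_
    rw [hYw_apply, map_smul, smul_eq_mul, PseudoRiemannianMetric.innerDual_comm]
    rfl
  -- Step 4: identify the two limits
  have hlim1 : Tendsto (fun n ↦ ∫ x, u n x * L x ∂μ) atTop (𝓝 (-∫ x in D, F x * ζ x ∂μ)) :=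
    (hweak ζ hζ).congr fun n ↦ hstep (u n) ((hus n).of_le (by norm_cast))
  have heq := tendsto_nhds_unique hlim1 hlimL
  rw [hvw, hwfin] at heq
  have hFζ : ∫ x in D, F x * ζ x ∂μ = ∫ x, F x * ζ x ∂μ :=
    setIntegral_eq_integral_of_forall_compl_eq_zero fun x hx ↦ by
      rw [hζzero x (fun h' ↦ hx (hOD h')), mul_zero]
  rw [hFζ, neg_inj] at heq
  -- conclude
  have hi5 : Integrable (fun x ↦ ζ x * (ofRiemannian h).vectorDivergence Yw x) μ :=
    integrable_of_continuous_of_hasCompactSupport h (hζ.continuous.mul hdivc) hζc.mul_right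
  have hi6 : Integrable (fun x ↦ ζ x * F x) μ :=
    integrable_of_continuous_of_hasCompactSupport h (hζ.continuous.mul hF) hζc.mul_right
  calc ∫ x, ζ x * ((ofRiemannian h).vectorDivergence Yw x - F x) ∂μ
      = ∫ x, ζ x * (ofRiemannian h).vectorDivergence Yw x ∂μ - ∫ x, ζ x * F x ∂μ := by
        rw [← integral_sub hi5 hi6]
        refine integral_congr_ae (Eventually.of_forall fun x ↦ ?_)
        ring
    _ = 0 := by
        rw [← heq, sub_eq_zero]
        exact integral_congr_ae (Eventually.of_forall fun x ↦ mul_comm _ _)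

end Literature.Geometry.Riemannian

end
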